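import Summits.QuantumFields.YangMills.Theorems.BalabanUVNodesN15LiveGluedPropagatorZeroField
import HarnessLib

/-!
# N15 = NE2 — Σ-col (I-c): THE η-DEFECT OF THE INCREMENT `G(U) − Δ_a⁻¹ ⊗ 1_ι` IS η-SMALL: `𝔇(X′ − G′⊗1, X − G⊗1) ≤ K·(θ + κ_e r_A η)·e^{−δd}`
# (dag-n15-a g28, programme Σ-col, FILE (I-c); node N15 = NE2; `--kind proof --supports stmt-QuantumFields-27366 --as helper`, count-neutral, ONE theorem, 0 def)

WHY.  The U-live site and unit layers on dag-n15-c's coloured carrier (Σ-col (J)) need, besides the decay of the background matrix `Z(A) = (Q⊗1)(X − G⊗1)(Q*⊗1)` at each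
spacing, its η-DIFFERENCE between the two spacings (Σ-col (H) `exDress_deltaCol_letters` (iii)): through King's pairing that difference is `(Q′⊗1)∘𝔇(X′ − G′⊗1, X − G⊗1)∘…`
plus dag-n15-c's averaging-defect rows.  Here the middle letter: the two-grid η-defect of the INCREMENT is η-small — NOT because the increment is (it is `O(r_A)`, FILE (I-b)),
but because `𝔇` is linear in the pair ([T4] `idef_sub`): `𝔇(X′ − G′⊗1, X − G⊗1) = 𝔇(X′, X) − 𝔇(G′⊗1, G⊗1)`, and both terms are η-small with exponential decay —
FILE 130 `sf_idef_cvGlued` (`D·(θ + R_e r_A η)`, `θ = (L^k)^{−1/16}`) and FILE 21 `uniform_layer_fullGM₂` conjunct 6 (`m₀·(L^k)^{−γ}`, `γ = 1/16`).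

Honest label: MODEL operator ∕ class ∕ pairing ∕ carriers exactly as FILE 130∕133 (NOT [B9] Thm 3.1 as printed); an estimate on the operator-layer ingredient only; no count.
[cite: Balaban1985BackgroundPropagators, Thm 3.1 (3.42) p.397 (η-rate: shape), (3.62)–(3.65) pp.402–403; Balaban1984PropagatorsI, Prop. 1.2 (1.110)–(1.111) p.35; King1986, p.664 (pairing)]
-/

open scoped BigOperators Matrix Matrix.Norms.Frobenius

namespace Summit.QuantumFields.YangMills.BalabanUVNodes.N15.GluedZeroField

open Literature.MathematicalPhysics.QuantumFieldTheory.Balaban1983to89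
open Literature.MathematicalPhysics.QuantumFieldTheory.Balaban1983to89.B5Prop11Plancherel (Tor fine)
open Literature.MathematicalPhysics.QuantumFieldTheory.Balaban1983to89.B11SectG (BlockNorm HasMaj)
open Literature.MathematicalPhysics.QuantumFieldTheory.Balaban1983to89.B6UnitTorusCarrier (unitTorusGeo unitTorusGeo_dist_nonneg)
open Literature.MathematicalPhysics.QuantumFieldTheory.Balaban1983to89.T4EtaRateDefect (idef idef_sub)
open Literature.MathematicalPhysics.QuantumFieldTheory.Balaban1983to89.T4EtaRateCoeffDefect (pull)
open Literature.Barriers.QuantumFields (traceForm)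
open Summit.QuantumFields.YangMills.BalabanUVNodes.N15.BackgroundLayer (gavgM uniform_layer_fullGM₂)
open Summit.QuantumFields.YangMills.BalabanUVNodes.N15.SiteLayer (hasMaj_exp_mono)
open Summit.QuantumFields.YangMills.BalabanUVNodes.N15.VectorPiece (bshiftEquiv kingPrV tensorId)
open Summit.QuantumFields.YangMills.BalabanUVNodes.N15.MatrixSpecies (basisConst basisConst_nonneg liftBlk liftMap)
open Summit.QuantumFields.YangMills.BalabanUVNodes.N15.TwoGrid (gOp)
open Summit.QuantumFields.YangMills.BalabanUVNodes.N15.Gluing (cvM CvX CvX' cvBlk CvNorm cvNL cvNL' cvGlued cvGlued' sf_idef_cvGlued)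

variable {d : ℕ} {L : ℕ} [NeZero L]

set_option maxHeartbeats 800000 in
/-- ★★★ **THE η-DEFECT OF THE INCREMENT IS η-SMALL**: `∃ δ w₀ R₀ K > 0` (from `d, L, a, ι`) such that in FILE 130∕133's regime the two-grid η-defect through King's pairing
`⊗ 1_ι` of the pair of increments `(X′(A′) − G′ ⊗ 1_ι, X(A′) − G ⊗ 1_ι)` has the block majorant `K·((L^k)^{−1/16} + κ_e·r_A·L^{−k})·e^{−δ|y−y′|}` from the cover's coarse
blocks to its fine blocks.  (`𝔇` is linear in the pair: FILE 130's defect of the live pair minus FILE 21's defect of `(G′, G) ⊗ 1_ι`.)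
[cite: Balaban1985BackgroundPropagators, Thm 3.1 (3.42) p.397 (shape); Balaban1984PropagatorsI, Prop. 1.2 (1.110)–(1.111) p.35; King1986, p.664] -/
theorem exists_hasMaj_idef_cvGlued_sub_tensorId_gOp (hL : Odd L ∧ 1 < L) (hL7 : 7 ≤ L) {a : ℝ} (ha : 0 < a) (ι : Type) [Fintype ι] [DecidableEq ι] [Nonempty ι] :
    ∃ δ w₀ R₀ K : ℝ, 0 < δ ∧ 0 < R₀ ∧ 0 < K ∧
      ∀ (mv kk r : ℕ), 1 ≤ kk → w₀ ≤ ((L ^ mv : ℕ) : ℝ) →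
      ∀ {mm : Type} [Fintype mm] [DecidableEq mm] (e : Matrix mm mm ℂ ≃L[ℝ] (ι → ℝ)), (∀ A B : Matrix mm mm ℂ, traceForm A B = e A ⬝ᵥ e B) →
      ∀ (A' : Fin (d + 1) → CvX' d L mv kk r hL → Matrix mm mm ℂ), (∀ μ x', (A' μ x')ᴴ = -A' μ x') →
      ∀ (rA : ℝ), 0 ≤ rA → (∀ μ x', ‖A' μ x'‖ ≤ rA) →
        (∀ μ κ x', ‖A' μ (bshiftEquiv (cvM d L mv kk hL) (L ^ r * L ^ kk) κ x') - A' μ x'‖ ≤ rA * ((((L ^ r * L ^ kk : ℕ) : ℝ))⁻¹)) →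
        (∀ μ κ x', ‖(A' μ (bshiftEquiv (cvM d L mv kk hL) (L ^ r * L ^ kk) κ x') - A' μ x') -
            (A' μ (bshiftEquiv (cvM d L mv kk hL) (L ^ r * L ^ kk) κ ((bshiftEquiv (cvM d L mv kk hL) (L ^ r * L ^ kk) μ).symm x')) -
              A' μ ((bshiftEquiv (cvM d L mv kk hL) (L ^ r * L ^ kk) μ).symm x'))‖ ≤ rA * ((((L ^ r * L ^ kk : ℕ) : ℝ))⁻¹) * ((((L ^ r * L ^ kk : ℕ) : ℝ))⁻¹)) →
        2 * ((1 + Fintype.card (Fin (d + 1))) * ((3 + 2 * ((d : ℝ) + 1)) * rA)) ≤ 1 →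
        (14 * Real.exp 1 * (1 + Fintype.card (Fin (d + 1))) * basisConst e * ((1 + Fintype.card (Fin (d + 1))) * ((3 + 2 * ((d : ℝ) + 1)) * rA))) * (1 + Fintype.card (Fin (d + 1) ⊕ Fin (d + 1))) ≤ R₀ →
        HasMaj (CvNorm d L mv kk hL ι) (BlockNorm.ofBlocks (unitTorusGeo L kk (cvM d L mv kk hL)) (liftBlk (cvBlk d L mv kk hL ∘ kingPrV L kk r (cvM d L mv kk hL)) ι))
          (idef (pull (liftMap (kingPrV L kk r (cvM d L mv kk hL)) ι)) (pull (liftMap (kingPrV L kk r (cvM d L mv kk hL)) ι))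
            (cvGlued' d L mv kk r hL a ((((L ^ r * L ^ kk : ℕ) : ℝ))⁻¹) ι e (fun _ _ => (1 : Matrix mm mm ℂ)) (fun μ x' => NormedSpace.exp (((((L ^ r * L ^ kk : ℕ) : ℝ))⁻¹) • A' μ x'))
                (cvNL' d L mv kk r hL a ι) (fun _ => 0) -
              tensorId ι (gOp (cvM d L mv kk hL) (L ^ r * L ^ kk) a))
            (cvGlued d L mv kk hL a ((((L ^ kk : ℕ) : ℝ))⁻¹) ι e (fun _ _ => (1 : Matrix mm mm ℂ))
                (fun μ x => NormedSpace.exp (((((L ^ kk : ℕ) : ℝ))⁻¹) • gavgM (Matrix mm mm ℂ) (Fin (d + 1)) (kingPrV L kk r (cvM d L mv kk hL)) A' μ x)) (cvNL d L mv kk hL a ι) (fun _ => 0) -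
              tensorId ι (gOp (cvM d L mv kk hL) (L ^ kk) a)))
          (fun y y' => K * ((((L ^ kk : ℕ) : ℝ)) ^ (-(1 / 16 : ℝ)) + basisConst e * rA * ((((L ^ kk : ℕ) : ℝ))⁻¹)) *
            Real.exp (-(δ * (unitTorusGeo L kk (cvM d L mv kk hL)).dist y y'))) := by
  have hLpos : 0 < L := Nat.pos_of_ne_zero (NeZero.ne L)
  have hL2 : 2 ≤ L := le_trans (by norm_num) hL7
  obtain ⟨δ₁, w₀, R₀, D, hδ₁, hR₀, H⟩ := sf_idef_cvGlued (d := d) hL hL7 ha ι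
  obtain ⟨δG, βG, m₀, cT, mT, hδG, hδG₁, hβG, hm₀, -, -, -, HG⟩ :=
    uniform_layer_fullGM₂ d ι hL.1 hL2 hL ha (γ := 1 / 16) (by norm_num) le_rfl 0 (show 0 < δ₁ / 16 by positivity) le_rfl
  set R₁ : ℝ := 14 * Real.exp 1 * (1 + Fintype.card (Fin (d + 1))) * ((1 + Fintype.card (Fin (d + 1))) * (3 + 2 * ((d : ℝ) + 1))) * (1 + Fintype.card (Fin (d + 1) ⊕ Fin (d + 1)))
    with hR₁
  have hR₁0 : 0 < R₁ := by positivity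
  refine ⟨δG, w₀, R₀, |D| + m₀ + |D| * R₁, hδG, hR₀, by positivity, fun mv kk r hk hw₀ => ?_⟩
  intro mm _ _ e he A' hA' rA hrA h1 h2 h3 hr2 hRle
  set M := cvM d L mv kk hL with hM
  have hkpos : (0 : ℝ) < ((L ^ kk : ℕ) : ℝ) := Nat.cast_pos.mpr (pow_pos hLpos kk)
  have hθ0 : 0 ≤ (((L ^ kk : ℕ) : ℝ)) ^ (-(1 / 16 : ℝ)) := Real.rpow_nonneg hkpos.le _
  have hη0 : 0 ≤ ((((L ^ kk : ℕ) : ℝ))⁻¹) := inv_nonneg.mpr hkpos.le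
  have hκ0 : 0 ≤ basisConst e := basisConst_nonneg e
  have hRc : 14 * Real.exp 1 * (1 + Fintype.card (Fin (d + 1))) * basisConst e * ((1 + Fintype.card (Fin (d + 1))) * ((3 + 2 * ((d : ℝ) + 1)) * rA)) *
      (1 + Fintype.card (Fin (d + 1) ⊕ Fin (d + 1))) = R₁ * basisConst e * rA := by rw [hR₁]; ring
  -- FILE 130: the defect of the live pair (constant `D` of unknown sign ↦ `|D|`, rate `δ₁∕16 ≥ δ_G`)
  have hX := H mv kk r hk hw₀ e he A' hA' rA hrA h1 h2 h3 hr2 hRle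
  rw [hRc] at hX
  have hX' := hX.mono (K' := fun y y' => |D| * ((((L ^ kk : ℕ) : ℝ)) ^ (-(1 / 16 : ℝ)) + R₁ * basisConst e * rA * ((((L ^ kk : ℕ) : ℝ))⁻¹)) *
      Real.exp (-(δG * (unitTorusGeo L kk M).dist y y'))) fun y y' => by
    have hd0 := unitTorusGeo_dist_nonneg L kk M y y'
    have hs : 0 ≤ (((L ^ kk : ℕ) : ℝ)) ^ (-(1 / 16 : ℝ)) + R₁ * basisConst e * rA * ((((L ^ kk : ℕ) : ℝ))⁻¹) := by positivity
    calc D * ((((L ^ kk : ℕ) : ℝ)) ^ (-(1 / 16 : ℝ)) + R₁ * basisConst e * rA * ((((L ^ kk : ℕ) : ℝ))⁻¹)) * Real.exp (-(δ₁ / 16 * (unitTorusGeo L kk M).dist y y'))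
        ≤ |D| * ((((L ^ kk : ℕ) : ℝ)) ^ (-(1 / 16 : ℝ)) + R₁ * basisConst e * rA * ((((L ^ kk : ℕ) : ℝ))⁻¹)) * Real.exp (-(δ₁ / 16 * (unitTorusGeo L kk M).dist y y')) :=
          mul_le_mul_of_nonneg_right (mul_le_mul_of_nonneg_right (le_abs_self D) hs) (Real.exp_nonneg _)
      _ ≤ |D| * ((((L ^ kk : ℕ) : ℝ)) ^ (-(1 / 16 : ℝ)) + R₁ * basisConst e * rA * ((((L ^ kk : ℕ) : ℝ))⁻¹)) * Real.exp (-(δG * (unitTorusGeo L kk M).dist y y')) :=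
          mul_le_mul_of_nonneg_left (Real.exp_le_exp.mpr (by nlinarith)) (mul_nonneg (abs_nonneg D) hs)
  -- FILE 21 conjunct 6: the defect of `(G′, G) ⊗ 1_ι` (blocks `blkFine`, `blkFine ∘ kingPrV` = the cover's by `rfl`)
  obtain ⟨-, -, -, -, -, hDG0, -⟩ := HG (⟨mv + 1, kk, hk, r⟩, (0 : Fin (d + 1)))
  have hDG : HasMaj (CvNorm d L mv kk hL ι) (BlockNorm.ofBlocks (unitTorusGeo L kk M) (liftBlk (cvBlk d L mv kk hL ∘ kingPrV L kk r M) ι))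
      (idef (pull (liftMap (kingPrV L kk r M) ι)) (pull (liftMap (kingPrV L kk r M) ι)) (tensorId ι (gOp M (L ^ r * L ^ kk) a)) (tensorId ι (gOp M (L ^ kk) a)))
      (fun y y' => m₀ * ((L : ℝ) ^ kk) ^ (-(1 / 16 : ℝ)) * Real.exp (-(δG * (unitTorusGeo L kk M).dist y y'))) := hDG0
  have hcast : ((L : ℝ) ^ kk) = (((L ^ kk : ℕ) : ℝ)) := by push_cast; rfl
  rw [hcast] at hDG
  -- linearity of `𝔇` in the pair, and the constant
  rw [idef_sub]
  refine (hX'.sub hDG).mono fun y y' => ?_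
  have hE := Real.exp_nonneg (-(δG * (unitTorusGeo L kk M).dist y y'))
  have hx : 0 ≤ (((L ^ kk : ℕ) : ℝ)) ^ (-(1 / 16 : ℝ)) * Real.exp (-(δG * (unitTorusGeo L kk M).dist y y')) := mul_nonneg hθ0 hE
  have hy : 0 ≤ basisConst e * rA * ((((L ^ kk : ℕ) : ℝ))⁻¹) * Real.exp (-(δG * (unitTorusGeo L kk M).dist y y')) := mul_nonneg (mul_nonneg (mul_nonneg hκ0 hrA) hη0) hE
  have hm : 0 ≤ |D| * R₁ := mul_nonneg (abs_nonneg D) hR₁0.le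
  nlinarith [mul_nonneg (abs_nonneg D) hy, mul_nonneg hm₀.le hy, mul_nonneg hm hx]

end Summit.QuantumFields.YangMills.BalabanUVNodes.N15.GluedZeroField
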